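import Summits.QuantumFields.YangMills.Theorems.BalabanUVNodesN27AtRecord13CoPHHolder
import Summits.QuantumFields.YangMills.Theorems.BalabanUVNodesN27AtRecord13CoPHKeyedCore
import Summits.QuantumFields.YangMills.Theorems.BalabanUVNodesSpineReadingOfRecord13CoPHV
import Summits.QuantumFields.YangMills.Theorems.BalabanUVNodesN17AtSpineCarriers
import Summits.QuantumFields.YangMills.Theorems.BalabanUVNodesN27AtSpineReadingOfRecord13CoPH

/-!
# ★ V EDITION (dag-n20-d `Thm/BalabanUVNodesSpineReadingOfRecord13CoPHV` p590105 ✓ 00:36Z 2026-08-28: `crOfRecord₁₃VAt K₀ jcut sh` ∕ `crOfRecord₁₃V`, the reading of record WITH THE PHYSICAL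
# VOLUME LETTER `vol := F.side ^ 4` — «the RECORD pointer is the V edition; the v3 re-point of `PinnedAtLive` is this one token», pub-ymgap INBOX l.25713) = the token image of this
# lineage's v1.0-reading module under `crOfRecord₁₃At ↦ crOfRecord₁₃VAt`, `NE7.Core 1 1 ↦ NE7.Core 1 (F.side ^ 4)` (the witness form of the N19′ edge), face lemmas `…_crOfRecord₁₃At ↦ …VAt`;
# every carrier but `vol`∕`δ` is shared by `rfl` (`crOfRecord₁₃VAt_T_eq`); statements and proofs otherwise VERBATIM; the v1.0 module stays as landed.
# BalabanUVNodes ∕ N27 = binder B5 AT THE RECORD — N27 AT dag-n20-d's STAGE-13 `CoPH` **SPINE READING OF RECORD** `YMDAG.UVSplit.crOfRecord₁₃VAt K₀ jcut sh`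
# (`crOfRecord₁₃V jcut sh := crOfRecord₁₃VAt 0 jcut sh`; `Thm/BalabanUVNodesSpineReadingOfRecord13CoPH`, p590105 (V edition; v1.0 p587226), plan g78 WORD-CR13 ∕ plan g79 (A)): the KEYED COMPOSER (P)
# `spine_rec13CCoPHOn_of_keyedFacesP` and the R-β HOMES storey (Q) `spine_rec13CCoPHOn_of_homes₁₃CoPHOn_holder` INSTANTIATED at `cr := crOfRecord₁₃VAt K₀ jcut sh`, with the
# four K5-side slots READ OFF dag-n20-d's dictionary BY NAME — N20 ⟸ ANY keyed `RelWeightBound`-witness `W` at the reading's own carriers `classSet₁₃ ∕ weightA₁₃ ∕ weightB₁₃ ∕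
# badClass₁₃` (`relWeightBound_crOfRecord₁₃VAt`, the canonical `wInf`), N21 ⟸ ANY keyed `ShellWeightBound`-witness `Wsh` at the displayed shell split `sh` (`shellWeightBound_crOfRecord₁₃VAt`),
# N27x ∕ extraction ⟸ THE DICTIONARY THEOREM `keyedExtraction_crOfRecord₁₃VAt` under the LIVE-SELECTOR PIN `hsel` and the three laws `hU hζm hζ0` (dag-n19-d B‴ §2's display), the
# N19′ core edge ⟸ ANY keyed `NE7.Core … δ ∧ Summable δ` witness at the reading's shell-free cores (`core_crOfRecord₁₃VAt`, cores ≥ 0 by `core_nonneg_of_shellWeightBound` from the N21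
# witness); the K4 side generic (`P`, `rr`) in §1 and at dag-n22-e's regime home `RRec₁₃CoPHOn 𝔯 Rg` in the R-β currency with N17 GLUED in §2
# (cell `pub-ymgap`, HUMAN RULING D-0062 Track A, R134 seat `pub-ymgap-dag-n27-c` (N27 B5 composite, s2) gen 11; K3⁷ `SpineGivenEndpointR13SepCoPH` = stmt-QuantumFields-20544,
# `--kind proof --supports 20544 --as helper`; COUNT-NEUTRAL; THEOREMS ONLY, 0 `def`, 0 `sorry`; `N`-generic, `K₀`-generic, regime-generic, NO Theses import — item faces in leaf H
# `…N27SpineGivenEndpointR13SepCoPHSpineReadingOfRecordV`)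

WHY.  HOME trigger (t2-K5) of this lineage (HANDOFF §g11): until p590105 (V edition; v1.0 p587226) «no spine reading of record exists in the tree» and every N27 storey kept `cr : SpineReading₁₃CoPH N` a
PARAMETER (XL ∕ (Q) ∕ (R) ∕ leaves A–G).  dag-n20-d's file DEFINES the reading (run letters of record, σ-packed two-run keys, fibre-sum class weights on the datum of record,
`Bad := badKeysSigma … jcut`, canonical least weights `wInf ∕ wshInf`, canonical rate `deltaCan`; the persistence policy `jcut` and the shell split `sh` are its two DISPLAYED residual
letters — plan g79 (A): K3⁷ v2 stub 2 := the keyed faces at `crOfRecord₁₃V jcut sh` under `∃ jcut sh`) and proves the transfer lemmas and the extraction theorem.  This file is the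
composer's instance there: what a K3⁷ v2 `stub_expansion13H`-side consumer meets once `cr` is pinned — the N27x ∕ extraction slot is NO LONGER A STUB but the selector pin + laws,
and N20 ∕ N21 ∕ N19′ are asked in WITNESS form at named carriers (the sockets dag-n20-w1 p583724 ∕ dag-n21-d ∕ dag-n19-d∕-e fill).

WHAT IS KERNEL-CHECKED ([bookkeeping]; each ONE application of the parent with dag-n20-d's transfers in the K5 slots).
* §1 ★★ `spine_rec13CCoPHOn_at_crOfRecord₁₃VAt_of_keyedFacesP` — (P) `spine_rec13CCoPHOn_of_keyedFacesP` at `cr := crOfRecord₁₃VAt K₀ jcut sh`: ARBITRARY rates predicate `P` and rate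
  reading `rr` (`hrates`, `h19` reading `P`), K5 side in witness form + the extraction pin∕laws ⇒ `Spine` at `IsRecordOfRecord₁₃CCoPHOn F N Rg`.  (At `K₀ = 0` this IS the statement at
  `crOfRecord₁₃V jcut sh` — `crOfRecord₁₃V_eq` is `rfl` and the conclusion does not mention `cr`.)
* §2 ★★ `spine_rec13CCoPHOn_of_homes₁₃CoPHOn_holder_at_crOfRecord₁₃VAt` — (Q) §1 `spine_rec13CCoPHOn_of_homes₁₃CoPHOn_holder` at `cr := crOfRecord₁₃VAt K₀ jcut sh`: the five K4 SENTENCES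
  `S_N14 ∕ S_N15 ∕ S_N16Holder β ∕ S_N18 ∕ S_N22` and `S_D4` at dag-n22-e's regime home `RRec₁₃CoPHOn 𝔯 Rg` of ANY Stage-13 rate reading `𝔯` (N17 GLUED by dag-n17-a
  `YMDAG.N17.s_N17_of_D4_N18`), the K5 side in witness form + pin∕laws, the N19′ edge reading `∀ k, RatesHolderAt … (rateCarriersOfRecord₁₃CoPH 𝔯 … k) β` ⇒ `Spine` at the regime class —
  B5 with the SPINE reading pinned and the RATE reading by name (at `𝔯 := readingOfRecord₁₃CoPH w1 ℓ₃ ne2 ne1` both readings of record).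
* §3 ON THE LIVE-SELECTOR LINE (K3⁷ skeleton v2 145a664ea9c38a7b, registered 00:03Z 2026-08-28: `LiveSel`, stub 2's `PinnedAtLive jcut sh cr`; plan g79 Q-SEL l.25357: neither
  `Provisos₁₃CoPH` nor the guard pins the selector, so §1∕§2's per-tuple `hsel` over a WHOLE guard is NOT a theorem of the record — the composer reads them on `Rg ∧ LiveSel`):
  (the split lemma `spine_rec13CCoPHOn_of_split` is the v1.0 module's, imported) · ★★ `spine_rec13CCoPHOn_live_at_crOfRecord₁₃VAt_of_keyedFacesP` and
  ★★ `spine_rec13CCoPHOn_live_of_homes₁₃CoPHOn_holder_at_crOfRecord₁₃VAt` (§1∕§2 at `Rg := G ∧ LiveSel` spelled `N`-generically, `hsel` DISCHARGED with `E := EOfRecord₁₃ F N θ.toStage13Params`).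
Consumed BY NAME: dag-n20-d `crOfRecord₁₃VAt`, `classSet₁₃`, `weightA₁₃`, `weightB₁₃`, `badClass₁₃`, `ShellSplit₁₃CoPH`, `relWeightBound_crOfRecord₁₃VAt`, `shellWeightBound_crOfRecord₁₃VAt`,
`core_crOfRecord₁₃VAt`, `keyedExtraction_crOfRecord₁₃VAt` (p590105 (V edition; v1.0 p587226)) and `SpineCanonicalWeights.core_nonneg_of_shellWeightBound` (p586835); dag-n19-d B‴ `ppSelLiveOfRecord` ∕ `LocalBgMeasurable` ∕
`ZetaMeasurable` (`…N19TargetClassWeightsE1Keyed`); (P) p577468; (Q) p581033; dag-n17-a `s_N17_of_D4_N18`.  Nothing landed is edited or re-declared.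

HONEST FRAMING.  COMPOSITE-node bookkeeping BY NAME; no estimate; every displayed antecedent (the rates `P` ∕ the K4 sentences, the keyed N20 ∕ N21 ∕ N19′ WITNESSES at the
reading's carriers, the live-selector pin `θ.ppSel = ppSelLiveOfRecord …` and the laws `LocalBgMeasurable ∕ ZetaMeasurable ∕ 0 ≤ ζ`) is a HYPOTHESIS inhabited for no family today; the
shell split `sh` is NOT inhabited (NODE O); `jcut` unpinned (print leaves `j⋆` free); NE7 ∕ NE7b ∕ NE7c NOT PRINTED for d = 4 and NOT PROVED; nothing of Bałaban's asserted or
instantiated; no `Provisos₁₃CoPH` inhabitant claimed (K0⁷ open); N19 ∕ N20 ∕ N21 ∕ N27 NOT discharged (the chair books, R417); K3⁷ NOT claimed; v2 NOT registered (plan's); counts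
UNMOVED (typed 28∕28 · discharged 5∕27, A 5∕28); one finite four-torus programme at fixed `ε` — NOT ℝ⁴, NOT infinite volume, NOT OS, NOT a mass gap, NOT Clay.  No decl below
carries a cite tag.
-/

set_option autoImplicit false

namespace Summit.QuantumFields.YangMills.Theorems.BalabanUVNodesN27SpineRecord

open scoped BigOperators
open Literature.MathematicalPhysics.QuantumFieldTheory.Balaban1983to89
open Literature.MathematicalPhysics.QuantumFieldTheory.Balaban1983to89.T4Continuum
open Literature.MathematicalPhysics.QuantumFieldTheory.Balaban1983to89.Node00
open T4WeightBudget (RelWeightBound)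
open T4IndicatorShell (ShellWeightBound)
open T4ContinuumYM4Torus (ForSmallCouplings)
open Summit.QuantumFields.BalabanUV.T4Continuum.Spine
open YMDAG.UVSplit
open Summit.QuantumFields.YangMills.BalabanUVNodes.SpineCanonicalWeights (core_nonneg_of_shellWeightBound)
open Summit.QuantumFields.YangMills.BalabanUVNodes.N19TargetClassWeightsE1Keyed
open Summit.QuantumFields.YangMills.BalabanUVNodes.N16HolderDefs (S_N16Holder)
open Summit.QuantumFields.YangMills.BalabanUVNodes.SpineRatesHolder (RatesHolderAt)

variable {N : ℕ} [NeZero N] (K₀ : ℕ) (jcut : ℕ → ℕ) (sh : ShellSplit₁₃CoPH N K₀) (Rg : (F : T4Family) → Stage13HParams F N → Prop)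

/-! ## §1 The keyed composer at the spine reading of record — arbitrary rates predicate `P`, arbitrary rate reading `rr` -/

section KeyedP

variable (rr : (F : T4Family) → (θ : Stage13HParams F N) → θ.Provisos₁₃CoPH F N → (ℕ → ℝ) → List (ULoop F) → RateCarriers N)
  (P : ∀ {F : T4Family}, Datum F N → RateCarriers N → Prop)

/-- ★★ **N27 = B5 AT THE REGIME RECORD CLASS WITH THE SPINE READING PINNED AT dag-n20-d's `crOfRecord₁₃VAt K₀ jcut sh`** ((P) `spine_rec13CCoPHOn_of_keyedFacesP` at that `cr`): for every
family and every admissible Stage-13 tuple with provisos IN `Rg` — the live-selector pin `hsel` and the laws `hU hζm hζ0` (⇒ the extraction slot, by `keyedExtraction_crOfRecord₁₃VAt`), a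
keyed `RelWeightBound`-witness `W` at the reading's carriers (⇒ N20 at the reading, `relWeightBound_crOfRecord₁₃VAt`), a keyed `ShellWeightBound`-witness `Wsh` at the shell split `sh`
(⇒ N21, `shellWeightBound_crOfRecord₁₃VAt`, and cores ≥ 0), the rates `P (datumOfRecord₁₃CoPH F N θ hP) (rr F θ hP g₀ os)` (`hrates`) and the N19′ edge from them to SOME summable
`NE7.Core` rate at the shell-free cores (⇒ the edge at the reading's own `δ`, `core_crOfRecord₁₃VAt`) — give `Spine` at `IsRecordOfRecord₁₃CCoPHOn F N Rg`.  At `K₀ = 0` the spine reading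
is `crOfRecord₁₃V jcut sh` (`crOfRecord₁₃V_eq`, `rfl`).  `hsel` is PER TUPLE: at a regime inside the live-selector line it is read off the regime (§3); over the
bare item guard its ∀-form is NOT a theorem of the record (plan g79 Q-SEL) — use §3 + `spine_rec13CCoPHOn_of_split` there.  Every displayed antecedent a HYPOTHESIS (0∕1 today);
`sh` not inhabited; `jcut` free. [bookkeeping] -/
theorem spine_rec13CCoPHOn_at_crOfRecord₁₃VAt_of_keyedFacesP
    (hsel : ∀ (F : T4Family) (θ : Stage13HParams F N), θ.Provisos₁₃CoPH F N → Rg F θ → θ.Admissible F N →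
      ∃ E : B12.RunParams → ℝ, θ.ppSel = ppSelLiveOfRecord F N θ.ν θ.τ9 E (wOfRecord₉ F N θ.toStage9Params))
    (hU : ∀ (F : T4Family) (θ : Stage13HParams F N), θ.Provisos₁₃CoPH F N → Rg F θ → θ.Admissible F N → LocalBgMeasurable F N θ.ν)
    (hζm : ∀ (F : T4Family) (θ : Stage13HParams F N), θ.Provisos₁₃CoPH F N → Rg F θ → θ.Admissible F N → ZetaMeasurable F N θ.ζ)
    (hζ0 : ∀ (F : T4Family) (θ : Stage13HParams F N), θ.Provisos₁₃CoPH F N → Rg F θ → θ.Admissible F N → ∀ p g k s Pl Ql RS U V', 0 ≤ θ.ζ p g k s Pl Ql RS U V')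
    (h20 : ∀ (F : T4Family) (θ : Stage13HParams F N) (hP : θ.Provisos₁₃CoPH F N), Rg F θ → θ.Admissible F N → ∀ (g₀ : ℕ → ℝ) (os : List (ULoop F)),
      ∃ W : ℕ → ℝ, RelWeightBound 1 (classSet₁₃ θ K₀ g₀) (weightA₁₃ θ hP K₀ g₀ os) (weightB₁₃ θ hP K₀ g₀ os) (badClass₁₃ θ K₀ g₀ jcut) W)
    (h21 : ∀ (F : T4Family) (θ : Stage13HParams F N) (hP : θ.Provisos₁₃CoPH F N), Rg F θ → θ.Admissible F N → ∀ (g₀ : ℕ → ℝ) (os : List (ULoop F)),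
      ∃ Wsh : ℕ → ℝ, ShellWeightBound 1 (classSet₁₃ θ K₀ g₀) (weightA₁₃ θ hP K₀ g₀ os) (weightB₁₃ θ hP K₀ g₀ os) (sh F θ hP g₀ os).1 (sh F θ hP g₀ os).2 Wsh)
    (hrates : ∀ (F : T4Family) (θ : Stage13HParams F N) (hP : θ.Provisos₁₃CoPH F N), Rg F θ → θ.Admissible F N → ∀ (g₀ : ℕ → ℝ) (os : List (ULoop F)),
      P (datumOfRecord₁₃CoPH F N θ hP) (rr F θ hP g₀ os))
    (h19 : ∀ (F : T4Family) (θ : Stage13HParams F N) (hP : θ.Provisos₁₃CoPH F N), Rg F θ → θ.Admissible F N → ∀ (g₀ : ℕ → ℝ) (os : List (ULoop F)),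
      P (datumOfRecord₁₃CoPH F N θ hP) (rr F θ hP g₀ os) → letI : DecidableEq (Σ K, SiteSeqKey F (K₀ + K)) := Classical.decEq _
        ∃ δ : ℕ → ℝ, NE7.Core 1 (F.side ^ 4) (classSet₁₃ θ K₀ g₀) (badClass₁₃ θ K₀ g₀ jcut) (fun K t x => weightA₁₃ θ hP K₀ g₀ os K t x - (sh F θ hP g₀ os).1 K t x)
          (fun K t x => weightB₁₃ θ hP K₀ g₀ os K t x - (sh F θ hP g₀ os).2 K t x) δ ∧ Summable δ) :
    Spine (N := N) fun F D w => Node00.IsRecordOfRecord₁₃CCoPHOn F N Rg D w :=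
  spine_rec13CCoPHOn_of_keyedFacesP (cr := crOfRecord₁₃VAt K₀ jcut sh) (rr := rr) (Rg := Rg) (P := P)
    (fun F θ hP hRg hθ g₀ os => by
      obtain ⟨W, hW⟩ := h20 F θ hP hRg hθ g₀ os
      exact relWeightBound_crOfRecord₁₃VAt K₀ jcut sh θ hP g₀ os hW)
    (fun F θ hP hRg hθ g₀ os => by
      obtain ⟨Wsh, hWsh⟩ := h21 F θ hP hRg hθ g₀ os
      exact shellWeightBound_crOfRecord₁₃VAt K₀ jcut sh θ hP g₀ os hWsh)
    hrates
    (fun F θ hP hRg hθ g₀ os hPr => by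
      letI : DecidableEq (Σ K, SiteSeqKey F (K₀ + K)) := Classical.decEq _
      obtain ⟨Wsh, hWsh⟩ := h21 F θ hP hRg hθ g₀ os
      obtain ⟨δ, hδ, hsum⟩ := h19 F θ hP hRg hθ g₀ os hPr
      exact ⟨_, core_crOfRecord₁₃VAt K₀ jcut sh θ hP g₀ os (core_nonneg_of_shellWeightBound hWsh) hδ hsum⟩)
    (fun F θ hP hRg hθ _ _ => by
      obtain ⟨E, hE⟩ := hsel F θ hP hRg hθ
      exact keyedExtraction_crOfRecord₁₃VAt K₀ jcut sh θ hP E hE (hU F θ hP hRg hθ) (hζm F θ hP hRg hθ) (hζ0 F θ hP hRg hθ))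

end KeyedP

/-! ## §2 Both homes by name: the K4 sentences at dag-n22-e's regime home of ANY Stage-13 rate reading (R-β, N17 glued), the K5 side at the spine reading of record -/

section Homes

variable (β : ℝ) (𝔯 : RateReading₁₃CoPH N)

/-- ★★ **N27 = B5 AT THE REGIME RECORD CLASS FROM THE K4 SENTENCES AT `RRec₁₃CoPHOn 𝔯 Rg` (N16 AT EXPONENT `β`, N17 GLUED) AND THE K5 SIDE AT `crOfRecord₁₃VAt K₀ jcut sh`** ((Q) §1
`spine_rec13CCoPHOn_of_homes₁₃CoPHOn_holder` at that `cr`, `h17 := YMDAG.N17.s_N17_of_D4_N18 _ hD4 h18`): the five producer sentences + (D4), the keyed N20 ∕ N21 ∕ N19′ WITNESSES at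
the reading's carriers, the live-selector pin and laws, and the N19′ edge reading `∀ k, RatesHolderAt (datumOfRecord₁₃CoPH F N θ hP) (rateCarriersOfRecord₁₃CoPH 𝔯 F θ hP g₀ os k) β` ⇒
`Spine` at `IsRecordOfRecord₁₃CCoPHOn F N Rg`.  At `𝔯 := readingOfRecord₁₃CoPH w1 ℓ₃ ne2 ne1` and `K₀ = 0` BOTH readings are the readings of record; at `N = 2`, `Rg :=` the guard, leaf H
gives THE ITEM.  Every displayed antecedent a HYPOTHESIS (0∕1 today); NE3 at exponent β NOT PROVED. [bookkeeping] -/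
theorem spine_rec13CCoPHOn_of_homes₁₃CoPHOn_holder_at_crOfRecord₁₃VAt
    (h14 : S_N14 (RRec₁₃CoPHOn 𝔯 Rg)) (h15 : S_N15 (RRec₁₃CoPHOn 𝔯 Rg)) (h16 : S_N16Holder β (RRec₁₃CoPHOn 𝔯 Rg))
    (h18 : S_N18 (RRec₁₃CoPHOn 𝔯 Rg)) (h22 : S_N22 (RRec₁₃CoPHOn 𝔯 Rg)) (hD4 : S_D4 (RRec₁₃CoPHOn 𝔯 Rg))
    (hsel : ∀ (F : T4Family) (θ : Stage13HParams F N), θ.Provisos₁₃CoPH F N → Rg F θ → θ.Admissible F N →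
      ∃ E : B12.RunParams → ℝ, θ.ppSel = ppSelLiveOfRecord F N θ.ν θ.τ9 E (wOfRecord₉ F N θ.toStage9Params))
    (hU : ∀ (F : T4Family) (θ : Stage13HParams F N), θ.Provisos₁₃CoPH F N → Rg F θ → θ.Admissible F N → LocalBgMeasurable F N θ.ν)
    (hζm : ∀ (F : T4Family) (θ : Stage13HParams F N), θ.Provisos₁₃CoPH F N → Rg F θ → θ.Admissible F N → ZetaMeasurable F N θ.ζ)
    (hζ0 : ∀ (F : T4Family) (θ : Stage13HParams F N), θ.Provisos₁₃CoPH F N → Rg F θ → θ.Admissible F N → ∀ p g k s Pl Ql RS U V', 0 ≤ θ.ζ p g k s Pl Ql RS U V')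
    (h20 : ∀ (F : T4Family) (θ : Stage13HParams F N) (hP : θ.Provisos₁₃CoPH F N), Rg F θ → θ.Admissible F N → ∀ (g₀ : ℕ → ℝ) (os : List (ULoop F)),
      ∃ W : ℕ → ℝ, RelWeightBound 1 (classSet₁₃ θ K₀ g₀) (weightA₁₃ θ hP K₀ g₀ os) (weightB₁₃ θ hP K₀ g₀ os) (badClass₁₃ θ K₀ g₀ jcut) W)
    (h21 : ∀ (F : T4Family) (θ : Stage13HParams F N) (hP : θ.Provisos₁₃CoPH F N), Rg F θ → θ.Admissible F N → ∀ (g₀ : ℕ → ℝ) (os : List (ULoop F)),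
      ∃ Wsh : ℕ → ℝ, ShellWeightBound 1 (classSet₁₃ θ K₀ g₀) (weightA₁₃ θ hP K₀ g₀ os) (weightB₁₃ θ hP K₀ g₀ os) (sh F θ hP g₀ os).1 (sh F θ hP g₀ os).2 Wsh)
    (h19 : ∀ (F : T4Family) (θ : Stage13HParams F N) (hP : θ.Provisos₁₃CoPH F N), Rg F θ → θ.Admissible F N → ∀ (g₀ : ℕ → ℝ) (os : List (ULoop F)),
      (∀ k : ℕ, RatesHolderAt (datumOfRecord₁₃CoPH F N θ hP) (rateCarriersOfRecord₁₃CoPH 𝔯 F θ hP g₀ os k) β) →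
        letI : DecidableEq (Σ K, SiteSeqKey F (K₀ + K)) := Classical.decEq _
        ∃ δ : ℕ → ℝ, NE7.Core 1 (F.side ^ 4) (classSet₁₃ θ K₀ g₀) (badClass₁₃ θ K₀ g₀ jcut) (fun K t x => weightA₁₃ θ hP K₀ g₀ os K t x - (sh F θ hP g₀ os).1 K t x)
          (fun K t x => weightB₁₃ θ hP K₀ g₀ os K t x - (sh F θ hP g₀ os).2 K t x) δ ∧ Summable δ) :
    Spine (N := N) fun F D w => Node00.IsRecordOfRecord₁₃CCoPHOn F N Rg D w :=
  spine_rec13CCoPHOn_of_homes₁₃CoPHOn_holder (crOfRecord₁₃VAt K₀ jcut sh) β 𝔯 Rg h14 h15 h16 (YMDAG.N17.s_N17_of_D4_N18 _ hD4 h18) h18 h22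
    ((s_N20_sRec₁₃CoPHOn_iff (crOfRecord₁₃VAt K₀ jcut sh) Rg).mpr fun F θ hP hRg hθ g₀ os => by
      obtain ⟨W, hW⟩ := h20 F θ hP hRg hθ g₀ os
      exact relWeightBound_crOfRecord₁₃VAt K₀ jcut sh θ hP g₀ os hW)
    (by
      rintro F D g₀ os S ⟨θ, hP, hRg, hθ, -, rfl⟩
      obtain ⟨Wsh, hWsh⟩ := h21 F θ hP hRg hθ g₀ os
      exact shellWeightBound_crOfRecord₁₃VAt K₀ jcut sh θ hP g₀ os hWsh)
    (fun F θ hP hRg hθ _ _ => by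
      obtain ⟨E, hE⟩ := hsel F θ hP hRg hθ
      exact keyedExtraction_crOfRecord₁₃VAt K₀ jcut sh θ hP E hE (hU F θ hP hRg hθ) (hζm F θ hP hRg hθ) (hζ0 F θ hP hRg hθ))
    (fun F θ hP hRg hθ g₀ os hk => by
      letI : DecidableEq (Σ K, SiteSeqKey F (K₀ + K)) := Classical.decEq _
      obtain ⟨Wsh, hWsh⟩ := h21 F θ hP hRg hθ g₀ os
      obtain ⟨δ, hδ, hsum⟩ := h19 F θ hP hRg hθ g₀ os hk
      exact ⟨_, core_crOfRecord₁₃VAt K₀ jcut sh θ hP g₀ os (core_nonneg_of_shellWeightBound hWsh) hδ hsum⟩)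

end Homes

/-! ## §3 The LIVE-SELECTOR LINE (plan g79 K3⁷ v2, registered 00:03Z 2026-08-28: `LiveSel F θ := θ.ppSel = ppSelLiveOfRecord F 2 θ.ν θ.τ9 (EOfRecord₁₃ F 2 θ.toStage13Params)
(wOfRecord₉ F 2 θ.toStage9Params)`, stub 2's `PinnedAtLive jcut sh cr`): §1∕§2 at a regime INSIDE the live line — `hsel` DISCHARGED by the regime — and the split of a regime
into its live and off-live parts.  (Plan g79 Q-SEL, pub-ymgap INBOX l.25357: neither `Provisos₁₃CoPH` nor the item's guard pins the selector, so «`hsel` at EVERY guarded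
admissible tuple» is NOT a theorem of the record as keyed; the K3⁷ composer therefore reads §1∕§2 at `Rg ∧ LiveSel` and supplies the off-live tuples separately — §3c.) -/

section Live

variable (G : (F : T4Family) → Stage13HParams F N → Prop)

/-- ★★ **§1 ON THE LIVE LINE OF A REGIME `G`** — `Rg F θ := G F θ ∧ (θ.ppSel = ppSelLiveOfRecord F N θ.ν θ.τ9 (EOfRecord₁₃ F N θ.toStage13Params) (wOfRecord₉ F N θ.toStage9Params))`
(the v2 skeleton's `LiveSel` spelled `N`-generically): the live-selector pin is READ OFF THE REGIME (`E := EOfRecord₁₃ F N θ.toStage13Params`), so the extraction slot at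
`crOfRecord₁₃VAt K₀ jcut sh` costs only the laws `hU hζm hζ0`; rates `P`, keyed N20 ∕ N21 ∕ N19′ witnesses as in §1, all asked on the live part of `G` only. [bookkeeping] -/
theorem spine_rec13CCoPHOn_live_at_crOfRecord₁₃VAt_of_keyedFacesP
    (rr : (F : T4Family) → (θ : Stage13HParams F N) → θ.Provisos₁₃CoPH F N → (ℕ → ℝ) → List (ULoop F) → RateCarriers N)
    (P : ∀ {F : T4Family}, Datum F N → RateCarriers N → Prop)
    (hU : ∀ (F : T4Family) (θ : Stage13HParams F N), θ.Provisos₁₃CoPH F N →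
      (G F θ ∧ θ.ppSel = ppSelLiveOfRecord F N θ.ν θ.τ9 (EOfRecord₁₃ F N θ.toStage13Params) (wOfRecord₉ F N θ.toStage9Params)) → θ.Admissible F N → LocalBgMeasurable F N θ.ν)
    (hζm : ∀ (F : T4Family) (θ : Stage13HParams F N), θ.Provisos₁₃CoPH F N →
      (G F θ ∧ θ.ppSel = ppSelLiveOfRecord F N θ.ν θ.τ9 (EOfRecord₁₃ F N θ.toStage13Params) (wOfRecord₉ F N θ.toStage9Params)) → θ.Admissible F N → ZetaMeasurable F N θ.ζ)
    (hζ0 : ∀ (F : T4Family) (θ : Stage13HParams F N), θ.Provisos₁₃CoPH F N →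
      (G F θ ∧ θ.ppSel = ppSelLiveOfRecord F N θ.ν θ.τ9 (EOfRecord₁₃ F N θ.toStage13Params) (wOfRecord₉ F N θ.toStage9Params)) → θ.Admissible F N →
        ∀ p g k s Pl Ql RS U V', 0 ≤ θ.ζ p g k s Pl Ql RS U V')
    (h20 : ∀ (F : T4Family) (θ : Stage13HParams F N) (hP : θ.Provisos₁₃CoPH F N),
      (G F θ ∧ θ.ppSel = ppSelLiveOfRecord F N θ.ν θ.τ9 (EOfRecord₁₃ F N θ.toStage13Params) (wOfRecord₉ F N θ.toStage9Params)) → θ.Admissible F N →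
        ∀ (g₀ : ℕ → ℝ) (os : List (ULoop F)),
          ∃ W : ℕ → ℝ, RelWeightBound 1 (classSet₁₃ θ K₀ g₀) (weightA₁₃ θ hP K₀ g₀ os) (weightB₁₃ θ hP K₀ g₀ os) (badClass₁₃ θ K₀ g₀ jcut) W)
    (h21 : ∀ (F : T4Family) (θ : Stage13HParams F N) (hP : θ.Provisos₁₃CoPH F N),
      (G F θ ∧ θ.ppSel = ppSelLiveOfRecord F N θ.ν θ.τ9 (EOfRecord₁₃ F N θ.toStage13Params) (wOfRecord₉ F N θ.toStage9Params)) → θ.Admissible F N →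
        ∀ (g₀ : ℕ → ℝ) (os : List (ULoop F)),
          ∃ Wsh : ℕ → ℝ, ShellWeightBound 1 (classSet₁₃ θ K₀ g₀) (weightA₁₃ θ hP K₀ g₀ os) (weightB₁₃ θ hP K₀ g₀ os) (sh F θ hP g₀ os).1 (sh F θ hP g₀ os).2 Wsh)
    (hrates : ∀ (F : T4Family) (θ : Stage13HParams F N) (hP : θ.Provisos₁₃CoPH F N),
      (G F θ ∧ θ.ppSel = ppSelLiveOfRecord F N θ.ν θ.τ9 (EOfRecord₁₃ F N θ.toStage13Params) (wOfRecord₉ F N θ.toStage9Params)) → θ.Admissible F N →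
        ∀ (g₀ : ℕ → ℝ) (os : List (ULoop F)), P (datumOfRecord₁₃CoPH F N θ hP) (rr F θ hP g₀ os))
    (h19 : ∀ (F : T4Family) (θ : Stage13HParams F N) (hP : θ.Provisos₁₃CoPH F N),
      (G F θ ∧ θ.ppSel = ppSelLiveOfRecord F N θ.ν θ.τ9 (EOfRecord₁₃ F N θ.toStage13Params) (wOfRecord₉ F N θ.toStage9Params)) → θ.Admissible F N →
        ∀ (g₀ : ℕ → ℝ) (os : List (ULoop F)), P (datumOfRecord₁₃CoPH F N θ hP) (rr F θ hP g₀ os) → letI : DecidableEq (Σ K, SiteSeqKey F (K₀ + K)) := Classical.decEq _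
          ∃ δ : ℕ → ℝ, NE7.Core 1 (F.side ^ 4) (classSet₁₃ θ K₀ g₀) (badClass₁₃ θ K₀ g₀ jcut) (fun K t x => weightA₁₃ θ hP K₀ g₀ os K t x - (sh F θ hP g₀ os).1 K t x)
            (fun K t x => weightB₁₃ θ hP K₀ g₀ os K t x - (sh F θ hP g₀ os).2 K t x) δ ∧ Summable δ) :
    Spine (N := N) fun F D w => Node00.IsRecordOfRecord₁₃CCoPHOn F N
      (fun F θ => G F θ ∧ θ.ppSel = ppSelLiveOfRecord F N θ.ν θ.τ9 (EOfRecord₁₃ F N θ.toStage13Params) (wOfRecord₉ F N θ.toStage9Params)) D w :=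
  spine_rec13CCoPHOn_at_crOfRecord₁₃VAt_of_keyedFacesP K₀ jcut sh _ rr P (fun _ _ _ hRg _ => ⟨_, hRg.2⟩) hU hζm hζ0 h20 h21 hrates h19

/-- ★★ **§2 ON THE LIVE LINE OF A REGIME `G`**: the K4 sentences at `RRec₁₃CoPHOn 𝔯 (G ∧ LiveSel)` (N16 at exponent `β`, N17 glued), the K5 witnesses and laws on the live part,
the N19′ edge reading `∀ k, RatesHolderAt …` — `hsel` read off the regime. [bookkeeping] -/
theorem spine_rec13CCoPHOn_live_of_homes₁₃CoPHOn_holder_at_crOfRecord₁₃VAt (β : ℝ) (𝔯 : RateReading₁₃CoPH N)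
    (h14 : S_N14 (RRec₁₃CoPHOn 𝔯 fun F θ => G F θ ∧ θ.ppSel = ppSelLiveOfRecord F N θ.ν θ.τ9 (EOfRecord₁₃ F N θ.toStage13Params) (wOfRecord₉ F N θ.toStage9Params)))
    (h15 : S_N15 (RRec₁₃CoPHOn 𝔯 fun F θ => G F θ ∧ θ.ppSel = ppSelLiveOfRecord F N θ.ν θ.τ9 (EOfRecord₁₃ F N θ.toStage13Params) (wOfRecord₉ F N θ.toStage9Params)))
    (h16 : S_N16Holder β (RRec₁₃CoPHOn 𝔯 fun F θ => G F θ ∧ θ.ppSel = ppSelLiveOfRecord F N θ.ν θ.τ9 (EOfRecord₁₃ F N θ.toStage13Params) (wOfRecord₉ F N θ.toStage9Params)))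
    (h18 : S_N18 (RRec₁₃CoPHOn 𝔯 fun F θ => G F θ ∧ θ.ppSel = ppSelLiveOfRecord F N θ.ν θ.τ9 (EOfRecord₁₃ F N θ.toStage13Params) (wOfRecord₉ F N θ.toStage9Params)))
    (h22 : S_N22 (RRec₁₃CoPHOn 𝔯 fun F θ => G F θ ∧ θ.ppSel = ppSelLiveOfRecord F N θ.ν θ.τ9 (EOfRecord₁₃ F N θ.toStage13Params) (wOfRecord₉ F N θ.toStage9Params)))
    (hD4 : S_D4 (RRec₁₃CoPHOn 𝔯 fun F θ => G F θ ∧ θ.ppSel = ppSelLiveOfRecord F N θ.ν θ.τ9 (EOfRecord₁₃ F N θ.toStage13Params) (wOfRecord₉ F N θ.toStage9Params)))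
    (hU : ∀ (F : T4Family) (θ : Stage13HParams F N), θ.Provisos₁₃CoPH F N →
      (G F θ ∧ θ.ppSel = ppSelLiveOfRecord F N θ.ν θ.τ9 (EOfRecord₁₃ F N θ.toStage13Params) (wOfRecord₉ F N θ.toStage9Params)) → θ.Admissible F N → LocalBgMeasurable F N θ.ν)
    (hζm : ∀ (F : T4Family) (θ : Stage13HParams F N), θ.Provisos₁₃CoPH F N →
      (G F θ ∧ θ.ppSel = ppSelLiveOfRecord F N θ.ν θ.τ9 (EOfRecord₁₃ F N θ.toStage13Params) (wOfRecord₉ F N θ.toStage9Params)) → θ.Admissible F N → ZetaMeasurable F N θ.ζ)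
    (hζ0 : ∀ (F : T4Family) (θ : Stage13HParams F N), θ.Provisos₁₃CoPH F N →
      (G F θ ∧ θ.ppSel = ppSelLiveOfRecord F N θ.ν θ.τ9 (EOfRecord₁₃ F N θ.toStage13Params) (wOfRecord₉ F N θ.toStage9Params)) → θ.Admissible F N →
        ∀ p g k s Pl Ql RS U V', 0 ≤ θ.ζ p g k s Pl Ql RS U V')
    (h20 : ∀ (F : T4Family) (θ : Stage13HParams F N) (hP : θ.Provisos₁₃CoPH F N),
      (G F θ ∧ θ.ppSel = ppSelLiveOfRecord F N θ.ν θ.τ9 (EOfRecord₁₃ F N θ.toStage13Params) (wOfRecord₉ F N θ.toStage9Params)) → θ.Admissible F N →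
        ∀ (g₀ : ℕ → ℝ) (os : List (ULoop F)),
          ∃ W : ℕ → ℝ, RelWeightBound 1 (classSet₁₃ θ K₀ g₀) (weightA₁₃ θ hP K₀ g₀ os) (weightB₁₃ θ hP K₀ g₀ os) (badClass₁₃ θ K₀ g₀ jcut) W)
    (h21 : ∀ (F : T4Family) (θ : Stage13HParams F N) (hP : θ.Provisos₁₃CoPH F N),
      (G F θ ∧ θ.ppSel = ppSelLiveOfRecord F N θ.ν θ.τ9 (EOfRecord₁₃ F N θ.toStage13Params) (wOfRecord₉ F N θ.toStage9Params)) → θ.Admissible F N →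
        ∀ (g₀ : ℕ → ℝ) (os : List (ULoop F)),
          ∃ Wsh : ℕ → ℝ, ShellWeightBound 1 (classSet₁₃ θ K₀ g₀) (weightA₁₃ θ hP K₀ g₀ os) (weightB₁₃ θ hP K₀ g₀ os) (sh F θ hP g₀ os).1 (sh F θ hP g₀ os).2 Wsh)
    (h19 : ∀ (F : T4Family) (θ : Stage13HParams F N) (hP : θ.Provisos₁₃CoPH F N),
      (G F θ ∧ θ.ppSel = ppSelLiveOfRecord F N θ.ν θ.τ9 (EOfRecord₁₃ F N θ.toStage13Params) (wOfRecord₉ F N θ.toStage9Params)) → θ.Admissible F N →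
        ∀ (g₀ : ℕ → ℝ) (os : List (ULoop F)),
          (∀ k : ℕ, RatesHolderAt (datumOfRecord₁₃CoPH F N θ hP) (rateCarriersOfRecord₁₃CoPH 𝔯 F θ hP g₀ os k) β) →
            letI : DecidableEq (Σ K, SiteSeqKey F (K₀ + K)) := Classical.decEq _
            ∃ δ : ℕ → ℝ, NE7.Core 1 (F.side ^ 4) (classSet₁₃ θ K₀ g₀) (badClass₁₃ θ K₀ g₀ jcut) (fun K t x => weightA₁₃ θ hP K₀ g₀ os K t x - (sh F θ hP g₀ os).1 K t x)
              (fun K t x => weightB₁₃ θ hP K₀ g₀ os K t x - (sh F θ hP g₀ os).2 K t x) δ ∧ Summable δ) :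
    Spine (N := N) fun F D w => Node00.IsRecordOfRecord₁₃CCoPHOn F N
      (fun F θ => G F θ ∧ θ.ppSel = ppSelLiveOfRecord F N θ.ν θ.τ9 (EOfRecord₁₃ F N θ.toStage13Params) (wOfRecord₉ F N θ.toStage9Params)) D w :=
  spine_rec13CCoPHOn_of_homes₁₃CoPHOn_holder_at_crOfRecord₁₃VAt K₀ jcut sh _ β 𝔯 h14 h15 h16 h18 h22 hD4 (fun _ _ _ hRg _ => ⟨_, hRg.2⟩) hU hζm hζ0 h20 h21 h19

end Live

end Summit.QuantumFields.YangMills.Theorems.BalabanUVNodesN27SpineRecord
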